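import Summits.BirchSwinnertonDyer.BirchSwinnertonDyer.Theorems.ErratumRoadFiveNonSurjCornerOfItemsR25
import HarnessLib

/-!
# Route `ErratumRoadFive` (rung K2), crux `NonSurjCorner` (item stmt-BirchSwinnertonDyer-19065): THE GLUE ITEM `NonSurjCornerOfItems` (23049)
# RE-CLOSED MODULO ROUTE ITEMS WITHOUT THE ASIDED `ShimuraCarrierLabelsB6FromFive` (27982) AND WITHOUT `ShimuraCasselsTateLevelInputs`
# (cell `bsd-stepL`, seat `bsd-stepL-corner-p1` g20; `--supports stmt-BirchSwinnertonDyer-23049 --as helper`)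

WHY THIS FILE. The generated glue of 19065's gen-3 split, `NonSurjCornerOfItems : NonSurjCornerKolyZDeep → NonSurjCornerTwinMuAnDeep →
KatoTwinFactsFiveAnContra → NonSurjCorner` (item 23049), was closed modulo items by `nonSurjCornerOfItems_of_items` (g18, p654414) over
{19066, 19064, 27981, 19524, 19716, `ShimuraCasselsTateLevelInputs`, `ShimuraCarrierLabelsB6FromFive` (27982)}. Since then (g18 road B, g19 (K),
glue #26) the LAB input 27982 — now ASIDE, «out of every cone» (ER5 rev 63, RULING 76 E1) — and the levelwise Cassels–Tate name (a tree theorem) have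
left the line. This file re-closes the glue over the CURRENT inputs: the five print items + the one print name of line edition r25
(`Literature.….shimuraCurve_heegnerSystem_primitivesFromFiveIrr`, no route item yet), via `nonSurjCorner_of_items_r25` (p667178).
* `nonSurjCornerOfItems_of_items_r25 (h₅ : PublishedInputsFive) (h₃ : X11aLowerHalf) (hGr : EulerHalfGrossPrintFacts)
  (hJL : ShimuraParametrizationDataNonempty) (hCO : PastenComponentOrdersInput) (hPrim : …primitivesFromFiveIrr) : NonSurjCornerOfItems`.

HONEST FRAMING: ONE composition (no definition, no named fact, no `sorry`); the glue decl is proved modulo five route items + one displayed print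
name; 23049 stays ledger-open (RULING 67 (a)); 19065 NOT closed; nothing about any curve (T7); BSD is proved for no curve.
[cite: Cha2005, Thm. 21 and Rmk. 25] [cite: Miller2011LMS, Def. 1.1]
-/

set_option autoImplicit false
set_option linter.dupNamespace false -- `Summit.BirchSwinnertonDyer.BirchSwinnertonDyer` (summit = problem), tree-wide

noncomputable section

namespace Summit.BirchSwinnertonDyer.BirchSwinnertonDyer.Theorems

open Literature.NumberTheory.EllipticCurves
  Summit.BirchSwinnertonDyer.BirchSwinnertonDyer.Theses.ErratumRoadFive

/-- **Glue 23049 modulo the CURRENT route items** (no LAB, no Cassels–Tate binder): `PublishedInputsFive` (19066), `X11aLowerHalf` (19064),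
`EulerHalfGrossPrintFacts` (27981), `ShimuraParametrizationDataNonempty` (19524), `PastenComponentOrdersInput` (19716) and the displayed print name
`shimuraCurve_heegnerSystem_primitivesFromFiveIrr` give `NonSurjCornerKolyZDeep → NonSurjCornerTwinMuAnDeep → KatoTwinFactsFiveAnContra → NonSurjCorner`
BY NAME, via `nonSurjCorner_of_items_r25`. CONDITIONAL; T7. [cite: Cha2005, Thm. 21 and Rmk. 25] [cite: Miller2011LMS, Def. 1.1] -/
theorem nonSurjCornerOfItems_of_items_r25
    (h₅ : Summit.BirchSwinnertonDyer.BirchSwinnertonDyer.Theses.ErratumRoadFive.PublishedInputsFive)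
    (h₃ : Summit.BirchSwinnertonDyer.BirchSwinnertonDyer.Theses.ErratumRoadFive.X11aLowerHalf)
    (hGr : Summit.BirchSwinnertonDyer.BirchSwinnertonDyer.Theses.ErratumRoadFive.EulerHalfGrossPrintFacts)
    (hJL : Summit.BirchSwinnertonDyer.BirchSwinnertonDyer.Theses.ErratumRoadFive.ShimuraParametrizationDataNonempty)
    (hCO : Summit.BirchSwinnertonDyer.BirchSwinnertonDyer.Theses.ErratumRoadFive.PastenComponentOrdersInput)
    (hPrim : shimuraCurve_heegnerSystem_primitivesFromFiveIrr) :
    Summit.BirchSwinnertonDyer.BirchSwinnertonDyer.Theses.ErratumRoadFive.NonSurjCornerOfItems :=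
  fun hZ hμ hF ↦ nonSurjCorner_of_items_r25 hZ hμ hF h₃ h₅ hGr hJL hCO hPrim

end Summit.BirchSwinnertonDyer.BirchSwinnertonDyer.Theorems

end
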